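import Summits.Ventures.HSemireg.WedgeHankelRecurrenceCensusScheme
import Summits.Ventures.HSemireg.WedgeHankelRecurrenceSymbol

/-!
# Venture HSemireg — THE CLASSES KILLED BY A GIVEN MONIC `m` (Gauss's `Σ_{d ∣ m} φ(d) = |K[X]/(m)|` read on classes): for `m` monic of degree `d ≤ N + 1`, **exactly `s^d` classes `v` on
# `[0, N]` satisfy the recurrence `m` (`m ∈ Rec^N_d(v)`)** — they are the dual classes `dualSeq m a`, `deg a < d` (N32); for `2d ≤ N + 1` **each of them is AFFINE, with minimal recurrence
# the unique monic divisor `m₁ = m / gcd(m, a)` of `m`**, so they split by minimal recurrence over the monic divisors of `m`: **`Σ_{m₁ ∣ m} #{v : R^N(v) = deg m₁, m₁ ∈ Rec^N(v)} = s^{deg m}`,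
# i.e. `Σ_{m₁ ∣ m} φ(m₁) = s^{deg m}`** (N53's fibres); for `m = p^k`, `p` irreducible: `Σ_{j ≤ k} φ(p^j) = s^{k·deg p}`

HONEST FRAMING. Part of the Lean index of the computation cell `pub-hsemireg` (seat p10 gen 29, Sunday typer «UNIFORM-IN-n»).
LINEAR ALGEBRA OF HANKEL (catalecticant) MATRICES and of polynomials over a field ONLY: no variety, no cohomology theory, no sheaf, no Ext group and no semiregularity map is constructed
here; nothing here says that HC / HC_CM / HC_AV holds; no Literature fact is declared or used.  Custodian versions as in `WedgeHankelSiegelIdeal` (1/3); the dictionary («classes whose apolar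
scheme is a closed subscheme of `{m = 0}`»; `φ` = Euler's function of `K[X]`, `φ(m₁) = #unitResidues m₁`, N53) is QUOTED, never asserted.

WHAT IS IN THE TREE.  N32 (`WedgeHankelRecurrenceDual`, № 263): `dualSeq`, `mem_recSpace_dualSeq`, `exists_dualSeq_of_mem_recSpace`, `dualSeq_unique`; N45 (`WedgeHankelRecurrenceSymbol`, № 327):
`rank_hankel1_half_dualSeq_of_factor`, `isCoprime_of_gcd_mul` (Kronecker, factorised form); N53 (`WedgeHankelRecurrenceCensusScheme`, № 371): `unitResidues`, `ncard_setOf_rank_eq_and_mem_recSpace`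
(the fibre over `m₁` has `φ(m₁)` classes); N44 (№ 326) `seqOf`, `seqOf_apply_of_lt`; N43 (№ 323) `IsAffineClass`, `exists_smul_eq_of_mem_recSpace_self`; N34 (№ 267) `rank_hankel1_half_congr`;
N23 (№ 176) `recSpace_congr`; N18 (№ 173) `map_mulRight_degreeLT_le_recSpace`, `mem_degreeLT_succ_iff`.  Mathlib: `Set.ncard_congr`, `Finset.card_eq_sum_card_fiberwise`, `Finset.sum_image`,
`dvd_prime_pow`, `UniqueFactorizationMonoid.irreducible_iff_prime`, `Polynomial.eq_of_monic_of_associated`, `Polynomial.monic_mul_leadingCoeff_inv`, `Polynomial.degreeLTEquiv`.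
THIS FILE (namespace `Summit.Ventures.HSemireg.Wedge.HankelOuter` continued; CHAINED on N53; 0 definitions):
* §584 **`ncard_setOf_mem_recSpace`** (`m` monic, `deg m ≤ N + 1 ⇒ #{v | m ∈ Rec^N_{deg m}(seqOf v)} = s^{deg m}`: the dual of `K[X]/(m)`).
* §585 **`exists_monic_dvd_of_mem_recSpace`** (`2 deg m ≤ N + 1`, `m ∈ Rec^N_{deg m}(q) ⇒ ∃ m₁` monic, `m₁ ∣ m`, `R^N(q) = deg m₁`, `Rec^N_{deg m₁}(q) = K·m₁`), **`isAffineClass_of_mem_recSpace`**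
  (such a class has NO node at `∞`), `eq_of_monic_of_rank_eq_of_mem_recSpace` (the monic minimal recurrence is unique), `mem_recSpace_of_dvd_of_mem_recSpace` (`m₁ ∣ m`, `m₁ ∈ Rec_{deg m₁} ⇒
  m ∈ Rec_{deg m}`).
* §586 GAUSS READ ON CLASSES: **`sum_ncard_setOf_rank_eq_and_mem_recSpace`** (for a finset `D` listing the monic divisors of `m`, `2 deg m ≤ N + 1`:
  `Σ_{m₁ ∈ D} #{v | R^N = deg m₁ ∧ m₁ ∈ Rec^N_{deg m₁}} = #{v | m ∈ Rec^N_{deg m}}`), **`sum_ncard_unitResidues_eq_pow`** (`Σ_{m₁ ∈ D} φ(m₁) = s^{deg m}`).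
* §587 PRIME POWERS: `monic_dvd_pow_iff_of_irreducible` (the monic divisors of `p^k` are the `p^j`, `j ≤ k`), **`sum_range_ncard_unitResidues_pow`** (`Σ_{j ≤ k} φ(p^j) = s^{k·deg p}`),
  `sum_range_ncard_setOf_rank_eq_and_mem_recSpace_pow` (the same on classes).
Nothing Ext-side.  New names only.
-/

open Module Polynomial
open scoped Matrix Polynomial

namespace Summit.Ventures.HSemireg.Wedge.HankelOuter

open Summit.Ventures.HSemireg.Wedge Summit.Ventures.HSemireg.Wedge.Hankel

variable (K : Type*) [Field K] {N : ℕ}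

/-! ## §584. All classes killed by `m`: the dual of `K[X]/(m)` -/

/-- **`s^{deg m}` CLASSES SATISFY THE RECURRENCE `m`: for `m` monic of degree `d ≤ N + 1`, `#{v on [0, N] | m ∈ Rec^N_d(v)} = s^d`** (`a ↦ dualSeq m a` is a bijection from `K[X]_{<d}`,
N32). -/
theorem ncard_setOf_mem_recSpace [Finite K] {m : K[X]} (hm : m.Monic) (hdN : m.natDegree ≤ N + 1) :
    {v : Fin (N + 1) → K | m ∈ recSpace K N (seqOf K v) m.natDegree}.ncard = Nat.card K ^ m.natDegree := by
  have h : (Polynomial.degreeLT K m.natDegree : Set K[X]).ncard = {v : Fin (N + 1) → K | m ∈ recSpace K N (seqOf K v) m.natDegree}.ncard := by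
    refine Set.ncard_congr (fun a _ => fun i : Fin (N + 1) => dualSeq K m a i) ?_ ?_ ?_
    · intro a _
      have hagree : ∀ j ≤ N, seqOf K (fun i : Fin (N + 1) => dualSeq K m a i) j = dualSeq K m a j := fun j hj => by
        rw [seqOf_apply_of_lt K _ (show j < N + 1 by omega)]
      rw [Set.mem_setOf_eq, recSpace_congr K hagree]
      exact mem_recSpace_dualSeq K hm a
    · intro a b ha hb h
      exact dualSeq_unique K (N := N) hm hdN ha hb fun j hj => by
        have := congrFun h ⟨j, by omega⟩
        exact this
    · intro v hv
      obtain ⟨a, ha, h⟩ := exists_dualSeq_of_mem_recSpace K hm hv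
      refine ⟨a, ha, funext fun i => ?_⟩
      rw [← h i (by have := i.2; omega), seqOf_apply_of_lt K v i.2]
  rw [← h, ← Nat.card_coe_set_eq, SetLike.coe_sort_coe, Nat.card_congr (Polynomial.degreeLTEquiv K m.natDegree).toEquiv, Nat.card_fun, Nat.card_eq_fintype_card (α := Fin m.natDegree),
    Fintype.card_fin]

/-! ## §585. A class killed by `m` is affine, with minimal recurrence a monic divisor of `m` -/

/-- **A CLASS KILLED BY THE MONIC `m` (`2 deg m ≤ N + 1`) HAS MIDDLE RANK `deg m₁` AND MINIMAL RECURRENCE LINE `K·m₁` FOR A UNIQUE MONIC DIVISOR `m₁` OF `m`** (`q = dualSeq m a` on `[0, N]`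
by N32; `m₁ = m / gcd(m, a)` made monic, Kronecker N45). -/
theorem exists_monic_dvd_of_mem_recSpace {m : K[X]} (hm : m.Monic) (h2 : m.natDegree + m.natDegree ≤ N + 1) {q : ℕ → K} (hq : m ∈ recSpace K N q m.natDegree) :
    ∃ m₁ : K[X], m₁.Monic ∧ m₁ ∣ m ∧ (hankel1 K N (N / 2) q).rank = m₁.natDegree ∧ recSpace K N q m₁.natDegree = K ∙ m₁ := by
  classical
  obtain ⟨a, -, hqa⟩ := exists_dualSeq_of_mem_recSpace K hm hq
  set g := EuclideanDomain.gcd m a with hg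
  have hg0 : g ≠ 0 := fun h => hm.ne_zero ((EuclideanDomain.gcd_eq_zero_iff.mp h).1)
  obtain ⟨m₁', hm₁'⟩ : g ∣ m := EuclideanDomain.gcd_dvd_left m a
  obtain ⟨a₁', ha₁'⟩ : g ∣ a := EuclideanDomain.gcd_dvd_right m a
  have hm₁'0 : m₁' ≠ 0 := fun h => hm.ne_zero (by rw [hm₁', h, mul_zero])
  have hcop' : IsCoprime m₁' a₁' := isCoprime_of_gcd_mul K hg0 hm₁' ha₁'
  set u := m₁'.leadingCoeff with hu
  have hu0 : u ≠ 0 := Polynomial.leadingCoeff_ne_zero.mpr hm₁'0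
  have hunit : IsUnit (Polynomial.C u⁻¹) := Polynomial.isUnit_C.mpr (Ne.isUnit (inv_ne_zero hu0))
  have hm₁ : (m₁' * Polynomial.C u⁻¹).Monic := Polynomial.monic_mul_leadingCoeff_inv hm₁'0
  have hCC : Polynomial.C u * Polynomial.C u⁻¹ = 1 := by rw [← Polynomial.C_mul, mul_inv_cancel₀ hu0, Polynomial.C_1]
  have hmg : m = (g * Polynomial.C u) * (m₁' * Polynomial.C u⁻¹) := by
    rw [hm₁']; calc g * m₁' = g * m₁' * (Polynomial.C u * Polynomial.C u⁻¹) := by rw [hCC, mul_one]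
      _ = (g * Polynomial.C u) * (m₁' * Polynomial.C u⁻¹) := by ring
  have hag : a = (g * Polynomial.C u) * (a₁' * Polynomial.C u⁻¹) := by
    rw [ha₁']; calc g * a₁' = g * a₁' * (Polynomial.C u * Polynomial.C u⁻¹) := by rw [hCC, mul_one]
      _ = (g * Polynomial.C u) * (a₁' * Polynomial.C u⁻¹) := by ring
  have hcop : IsCoprime (m₁' * Polynomial.C u⁻¹) (a₁' * Polynomial.C u⁻¹) := (isCoprime_mul_unit_right hunit m₁' a₁').mpr hcop'
  have hdeg : (m₁' * Polynomial.C u⁻¹).natDegree ≤ m.natDegree := by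
    rw [Polynomial.natDegree_mul_leadingCoeff_inv _ hm₁'0, hm₁', Polynomial.natDegree_mul hg0 hm₁'0]; omega
  obtain ⟨hR, hRec⟩ := rank_hankel1_half_dualSeq_of_factor K (N := N) hm hm₁ hmg hag hcop (by omega)
  refine ⟨m₁' * Polynomial.C u⁻¹, hm₁, Dvd.intro_left _ hmg.symm, ?_, ?_⟩
  · rw [rank_hankel1_half_congr K hqa]; exact hR
  · rw [recSpace_congr K hqa]; exact hRec

/-- **NO NODE AT `∞`: a class killed by a monic `m` in the window of its own degree (`2 deg m ≤ N + 1`) is AFFINE of rank `deg m₁`.** -/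
theorem isAffineClass_of_mem_recSpace {m : K[X]} (hm : m.Monic) (h2 : m.natDegree + m.natDegree ≤ N + 1) {q : ℕ → K} (hq : m ∈ recSpace K N q m.natDegree) :
    ∃ m₁ : K[X], m₁.Monic ∧ m₁ ∣ m ∧ IsAffineClass K N m₁.natDegree q := by
  obtain ⟨m₁, hm₁, hdvd, hR, hRec⟩ := exists_monic_dvd_of_mem_recSpace K hm h2 hq
  exact ⟨m₁, hm₁, hdvd, hR, m₁, by rw [hRec]; exact Submodule.mem_span_singleton_self m₁, hm₁.ne_zero, rfl⟩

/-- **THE MONIC MINIMAL RECURRENCE IS UNIQUE: two monic `m₁`, `m₂` with `R^N(q) = deg mᵢ` and `mᵢ ∈ Rec^N_{deg mᵢ}(q)` (`2R ≤ N + 1`) are equal** (the window is a line, N43). -/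
theorem eq_of_monic_of_rank_eq_of_mem_recSpace {q : ℕ → K} {m₁ m₂ : K[X]} (hm₁ : m₁.Monic) (hm₂ : m₂.Monic) (hR₁ : (hankel1 K N (N / 2) q).rank = m₁.natDegree)
    (hR₂ : (hankel1 K N (N / 2) q).rank = m₂.natDegree) (h2 : m₁.natDegree + m₁.natDegree ≤ N + 1) (h₁ : m₁ ∈ recSpace K N q m₁.natDegree) (h₂ : m₂ ∈ recSpace K N q m₂.natDegree) :
    m₁ = m₂ := by
  have hd : m₂.natDegree = m₁.natDegree := by rw [← hR₂, hR₁]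
  rw [hd] at h₂
  obtain ⟨c, hc⟩ := exists_smul_eq_of_mem_recSpace_self K hR₁ h2 h₁ hm₁.ne_zero h₂
  rw [Polynomial.smul_eq_C_mul] at hc
  have hlc := congrArg Polynomial.leadingCoeff hc
  rw [Polynomial.leadingCoeff_mul, Polynomial.leadingCoeff_C, hm₁.leadingCoeff, hm₂.leadingCoeff, mul_one] at hlc
  rw [hc, ← hlc, Polynomial.C_1, one_mul]

/-- a multiple in the right window: `m₁ ∣ m`, `m₁ ∈ Rec^N_{deg m₁}(q)`, `m₁ ≠ 0 ⇒ m ∈ Rec^N_{deg m}(q)`. -/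
theorem mem_recSpace_of_dvd_of_mem_recSpace {q : ℕ → K} {m₁ m : K[X]} (hm₁0 : m₁ ≠ 0) (hdvd : m₁ ∣ m) (h₁ : m₁ ∈ recSpace K N q m₁.natDegree) : m ∈ recSpace K N q m.natDegree := by
  obtain ⟨h, rfl⟩ := hdvd
  rcases eq_or_ne h 0 with rfl | hh0
  · rw [mul_zero]; exact Submodule.zero_mem _
  · have hmem := map_mulRight_degreeLT_le_recSpace K h₁ h.natDegree ⟨h, (mem_degreeLT_succ_iff K).mpr le_rfl, rfl⟩
    rw [LinearMap.mulRight_apply] at hmem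
    rwa [mul_comm, Polynomial.natDegree_mul hh0 hm₁0, add_comm]

/-! ## §586. Gauss for `K[X]`, read on classes: the classes killed by `m` split by minimal recurrence over the monic divisors of `m` -/

/-- **`Σ_{m₁ ∣ m, monic} #{v | R^N(v) = deg m₁ ∧ m₁ ∈ Rec^N_{deg m₁}(v)} = #{v | m ∈ Rec^N_{deg m}(v)}`** for `m` monic with `2 deg m ≤ N + 1` and any finset `D` listing exactly the monic divisors
of `m` (the fibres of `v ↦` its monic minimal recurrence, §585). -/
theorem sum_ncard_setOf_rank_eq_and_mem_recSpace [Finite K] {m : K[X]} (hm : m.Monic) (h2 : m.natDegree + m.natDegree ≤ N + 1) (D : Finset K[X])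
    (hD : ∀ m₁ : K[X], m₁ ∈ D ↔ m₁.Monic ∧ m₁ ∣ m) :
    ∑ m₁ ∈ D, {v : Fin (N + 1) → K | (hankel1 K N (N / 2) (seqOf K v)).rank = m₁.natDegree ∧ m₁ ∈ recSpace K N (seqOf K v) m₁.natDegree}.ncard
      = {v : Fin (N + 1) → K | m ∈ recSpace K N (seqOf K v) m.natDegree}.ncard := by
  classical
  haveI := Fintype.ofFinite K
  -- the monic minimal recurrence as a function into `D`
  let f : (Fin (N + 1) → K) → K[X] := fun v =>
    if h : ∃ m₁ : K[X], m₁.Monic ∧ m₁ ∣ m ∧ (hankel1 K N (N / 2) (seqOf K v)).rank = m₁.natDegree ∧ recSpace K N (seqOf K v) m₁.natDegree = K ∙ m₁ then Classical.choose h else m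
  have hf : ∀ v : Fin (N + 1) → K, m ∈ recSpace K N (seqOf K v) m.natDegree →
      (f v).Monic ∧ f v ∣ m ∧ (hankel1 K N (N / 2) (seqOf K v)).rank = (f v).natDegree ∧ recSpace K N (seqOf K v) (f v).natDegree = K ∙ f v := fun v hv => by
    have h := exists_monic_dvd_of_mem_recSpace K hm h2 hv
    simp only [f, dif_pos h]
    exact Classical.choose_spec h
  have hS : ∀ v : Fin (N + 1) → K, v ∈ (Finset.univ.filter fun v : Fin (N + 1) → K => m ∈ recSpace K N (seqOf K v) m.natDegree) ↔ m ∈ recSpace K N (seqOf K v) m.natDegree := fun v => by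
    rw [Finset.mem_filter]; exact ⟨fun h => h.2, fun h => ⟨Finset.mem_univ _, h⟩⟩
  have hmaps : ((Finset.univ.filter fun v : Fin (N + 1) → K => m ∈ recSpace K N (seqOf K v) m.natDegree) : Set (Fin (N + 1) → K)).MapsTo f (D : Finset K[X]) := fun v hv => by
    have hv' := (hS v).mp (Finset.mem_coe.mp hv)
    exact Finset.mem_coe.mpr ((hD _).mpr ⟨(hf v hv').1, (hf v hv').2.1⟩)
  have h := Finset.card_eq_sum_card_fiberwise hmaps
  have hlhs : {v : Fin (N + 1) → K | m ∈ recSpace K N (seqOf K v) m.natDegree}.ncard = (Finset.univ.filter fun v : Fin (N + 1) → K => m ∈ recSpace K N (seqOf K v) m.natDegree).card := by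
    rw [← Finset.coe_filter_univ, Set.ncard_coe_finset]
  rw [hlhs, h]
  refine Finset.sum_congr rfl fun m₁ hm₁D => ?_
  obtain ⟨hm₁, hdvd⟩ := (hD m₁).mp hm₁D
  rw [← Set.ncard_coe_finset, Finset.coe_filter]
  refine congrArg Set.ncard (Set.ext fun v => ?_)
  simp only [Set.mem_setOf_eq]
  rw [hS]
  constructor
  · rintro ⟨hR, hmem⟩
    have hv : m ∈ recSpace K N (seqOf K v) m.natDegree := mem_recSpace_of_dvd_of_mem_recSpace K hm₁.ne_zero hdvd hmem
    obtain ⟨hfm, -, hRf, hRecf⟩ := hf v hv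
    have hle := Polynomial.natDegree_le_of_dvd hdvd hm.ne_zero
    refine ⟨hv, eq_of_monic_of_rank_eq_of_mem_recSpace K hfm hm₁ hRf hR (by omega) ?_ hmem⟩
    rw [hRecf]; exact Submodule.mem_span_singleton_self _
  · rintro ⟨hv, hfv⟩
    obtain ⟨-, -, hR, hRec⟩ := hf v hv
    rw [hfv] at hR hRec
    exact ⟨hR, by rw [hRec]; exact Submodule.mem_span_singleton_self m₁⟩

/-- **GAUSS FOR `K[X]`: `Σ_{m₁ ∣ m, monic} φ(m₁) = s^{deg m}`** (`φ(m₁) = #unitResidues m₁`, N53; any finset `D` listing exactly the monic divisors of the monic `m`). -/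
theorem sum_ncard_unitResidues_eq_pow [Finite K] {m : K[X]} (hm : m.Monic) (D : Finset K[X]) (hD : ∀ m₁ : K[X], m₁ ∈ D ↔ m₁.Monic ∧ m₁ ∣ m) :
    ∑ m₁ ∈ D, (unitResidues K m₁).ncard = Nat.card K ^ m.natDegree := by
  have h2 : m.natDegree + m.natDegree ≤ (m.natDegree + m.natDegree - 1) + 1 := by omega
  rw [← ncard_setOf_mem_recSpace K (N := m.natDegree + m.natDegree - 1) hm (by omega), ← sum_ncard_setOf_rank_eq_and_mem_recSpace K hm h2 D hD]
  refine Finset.sum_congr rfl fun m₁ hm₁D => ?_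
  obtain ⟨hm₁, hdvd⟩ := (hD m₁).mp hm₁D
  have := Polynomial.natDegree_le_of_dvd hdvd hm.ne_zero
  rw [ncard_setOf_rank_eq_and_mem_recSpace K hm₁ (by omega)]

/-! ## §587. Prime powers: `Σ_{j ≤ k} φ(p^j) = s^{k·deg p}` -/

/-- the monic divisors of `p^k` (`p` monic irreducible) are exactly the `p^j`, `j ≤ k`. -/
theorem monic_dvd_pow_iff_of_irreducible {p : K[X]} (hp : p.Monic) (hirr : Irreducible p) (k : ℕ) (m₁ : K[X]) :
    (m₁.Monic ∧ m₁ ∣ p ^ k) ↔ ∃ j ≤ k, m₁ = p ^ j := by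
  constructor
  · rintro ⟨hm₁, hdvd⟩
    obtain ⟨j, hj, hassoc⟩ := (dvd_prime_pow (UniqueFactorizationMonoid.irreducible_iff_prime.mp hirr) k).mp hdvd
    exact ⟨j, hj, Polynomial.eq_of_monic_of_associated hm₁ (hp.pow j) hassoc⟩
  · rintro ⟨j, hj, rfl⟩
    exact ⟨hp.pow j, pow_dvd_pow p hj⟩

/-- **`Σ_{j ≤ k} φ(p^j) = s^{k·deg p}`** for `p` monic irreducible (the divisors `p^j` of `p^k`; with N54's `φ(p^j) = s^{dj} − s^{d(j−1)}` this is the telescoping sum, here obtained without it). -/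
theorem sum_range_ncard_unitResidues_pow [Finite K] {p : K[X]} (hp : p.Monic) (hirr : Irreducible p) (k : ℕ) :
    ∑ j ∈ Finset.range (k + 1), (unitResidues K (p ^ j)).ncard = Nat.card K ^ (k * p.natDegree) := by
  classical
  have hinj : Set.InjOn (fun j => p ^ j) (Finset.range (k + 1) : Set ℕ) := fun i _ j _ h => by
    have h' := congrArg Polynomial.natDegree h
    simp only [hp.natDegree_pow] at h'
    exact Nat.eq_of_mul_eq_mul_right (Polynomial.natDegree_pos_iff_degree_pos.mpr (Polynomial.degree_pos_of_irreducible hirr)) h'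
  rw [← hp.natDegree_pow k, ← sum_ncard_unitResidues_eq_pow K (hp.pow k) ((Finset.range (k + 1)).image fun j => p ^ j) fun m₁ => ?_, Finset.sum_image hinj]
  rw [Finset.mem_image, monic_dvd_pow_iff_of_irreducible K hp hirr]
  constructor
  · rintro ⟨j, hj, rfl⟩; exact ⟨j, by have := Finset.mem_range.mp hj; omega, rfl⟩
  · rintro ⟨j, hj, rfl⟩; exact ⟨j, Finset.mem_range.mpr (by omega), rfl⟩

/-- the same on classes: **`Σ_{j ≤ k} #{v | R^N(v) = j·deg p ∧ p^j ∈ Rec^N(v)} = s^{k·deg p}`** (`2k·deg p ≤ N + 1`). -/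
theorem sum_range_ncard_setOf_rank_eq_and_mem_recSpace_pow [Finite K] {p : K[X]} (hp : p.Monic) (hirr : Irreducible p) {k : ℕ} (h2 : (p ^ k).natDegree + (p ^ k).natDegree ≤ N + 1) :
    ∑ j ∈ Finset.range (k + 1), {v : Fin (N + 1) → K | (hankel1 K N (N / 2) (seqOf K v)).rank = (p ^ j).natDegree ∧ p ^ j ∈ recSpace K N (seqOf K v) (p ^ j).natDegree}.ncard
      = Nat.card K ^ (k * p.natDegree) := by
  classical
  have hinj : Set.InjOn (fun j => p ^ j) (Finset.range (k + 1) : Set ℕ) := fun i _ j _ h => by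
    have h' := congrArg Polynomial.natDegree h
    simp only [hp.natDegree_pow] at h'
    exact Nat.eq_of_mul_eq_mul_right (Polynomial.natDegree_pos_iff_degree_pos.mpr (Polynomial.degree_pos_of_irreducible hirr)) h'
  have hD : ∀ m₁ : K[X], m₁ ∈ (Finset.range (k + 1)).image (fun j => p ^ j) ↔ m₁.Monic ∧ m₁ ∣ p ^ k := fun m₁ => by
    rw [Finset.mem_image, monic_dvd_pow_iff_of_irreducible K hp hirr]
    constructor
    · rintro ⟨j, hj, rfl⟩; exact ⟨j, by have := Finset.mem_range.mp hj; omega, rfl⟩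
    · rintro ⟨j, hj, rfl⟩; exact ⟨j, Finset.mem_range.mpr (by omega), rfl⟩
  have h := sum_ncard_setOf_rank_eq_and_mem_recSpace K (hp.pow k) h2 _ hD
  rw [Finset.sum_image hinj, ncard_setOf_mem_recSpace K (hp.pow k) (by omega), hp.natDegree_pow] at h
  exact h

end Summit.Ventures.HSemireg.Wedge.HankelOuter
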